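import Mathlib
import Summits.Ventures.HodgeRepro.Tier4.Target
import Summits.Ventures.HodgeRepro.Tier4.Line3.ArchSize

/-!
# Tier4/Line3/Denominator — a common denominator for `I • 𝔞` (rung for L3.4 / L3.5)

Blind re-derivation cell `pub-hodge-repro`, Tier 4 «PROVE THE STEP» (README §9–§10), LINE L3, seat t4-L2-p3 on L3.5
`term_dominated` (lead S12234).

The Gram deviation of an off-main tuple of the depth-`N` ball lies in `I • 𝔞` with `I = (𝔭 𝔭̄)^N` and `𝔞 ⊆ E′` a FIXED
finitely generated `𝒪`-submodule (`GramCongruence.gramSpan`, S12405 (b)).  To feed it into the archimedean-size rung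
(`Majorant.rung_archimedean_size`: an INTEGRAL non-zero element of `𝔭^N` is large at some embedding) one clears the
denominators of `𝔞` once and for all:

* `exists_denom_smul_mem` — for a finitely generated `𝔞` there is `D₀ ≠ 0` in `𝒪` such that for EVERY ideal `I` and every
  `α ∈ I • 𝔞`, `D₀ • α = algebraMap β` for some `β ∈ I` (`IsLocalization.exist_integer_multiples_of_finset` on the
  generators, then `Submodule.smul_induction_on` / `Submodule.span_induction`);
* `rung_archimedean_size_of_mem_smul` — the consequence for `I = 𝔭^N`: a non-zero `α ∈ 𝔭^N • 𝔞` satisfies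
  `N(𝔭)^N ≤ ‖σ D₀‖^d · ‖σ α‖^d` at some embedding `σ` — the exact input of step 5 of LINE L3.

Nothing here asserts anything about the truth of (P); HC_CM is NOT proved by anyone in this repository.
-/

set_option autoImplicit false

namespace Summit.Ventures.HodgeRepro.Tier4.Line3

open NumberField

section Denominator

variable {R : Type*} [CommRing R] [IsDomain R] {E : Type*} [Field E] [Algebra R E] [IsFractionRing R E]

/-- **A common denominator for `I • 𝔞`.** For a finitely generated `R`-submodule `𝔞` of the fraction field `E` there is
`D₀ ≠ 0` in `R` with: for every ideal `I` of `R` and every `α ∈ I • 𝔞`, `D₀ • α` is the image of an element of `I`. -/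
theorem exists_denom_smul_mem {𝔞 : Submodule R E} (h : 𝔞.FG) :
    ∃ D₀ : R, D₀ ≠ 0 ∧ ∀ (I : Ideal R) (α : E), α ∈ I • 𝔞 → ∃ β ∈ I, algebraMap R E β = D₀ • α := by
  obtain ⟨s, hs⟩ := h
  obtain ⟨b, hb⟩ := IsLocalization.exist_integer_multiples_of_finset (nonZeroDivisors R) (S := E) s
  -- every element of `𝔞 = span s` becomes integral after multiplication by `b`
  have hint : ∀ g ∈ 𝔞, ∃ γ : R, algebraMap R E γ = (b : R) • g := by
    rw [← hs]
    intro g hg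
    refine Submodule.span_induction (fun a ha => ?_) ⟨0, by simp⟩
      (fun a₁ a₂ _ _ ⟨γ₁, e₁⟩ ⟨γ₂, e₂⟩ => ⟨γ₁ + γ₂, by rw [map_add, e₁, e₂, smul_add]⟩)
      (fun r a _ ⟨γ, e⟩ => ⟨r * γ, by rw [map_mul, e, Algebra.smul_def, Algebra.smul_def, Algebra.smul_def]; ring⟩) hg
    obtain ⟨γ, hγ⟩ := hb a ha
    exact ⟨γ, hγ⟩
  refine ⟨b, nonZeroDivisors.ne_zero b.2, fun I α hα => ?_⟩
  refine Submodule.smul_induction_on hα (fun r hr g hg => ?_)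
    (fun a₁ a₂ ⟨β₁, hβ₁, e₁⟩ ⟨β₂, hβ₂, e₂⟩ => ⟨β₁ + β₂, I.add_mem hβ₁ hβ₂, by rw [map_add, e₁, e₂, smul_add]⟩)
  obtain ⟨γ, hγ⟩ := hint g hg
  refine ⟨r * γ, I.mul_mem_right γ hr, ?_⟩
  rw [map_mul, hγ, Algebra.smul_def, Algebra.smul_def, Algebra.smul_def]
  ring

end Denominator

/-- **R5 FOR THE GRAM DEVIATION.** If `𝔞 ⊆ E` is a finitely generated `𝒪_E`-submodule with common denominator `D₀`
(as produced by `exists_denom_smul_mem`), then every non-zero `α ∈ 𝔭^N • 𝔞` satisfies `N(𝔭)^N ≤ ‖σ D₀‖^d · ‖σ α‖^d` at some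
embedding `σ : E →+* ℂ` (`d = [E : ℚ]`). -/
theorem rung_archimedean_size_of_mem_smul (E : Type) [Field E] [NumberField E]
    (p : IsDedekindDomain.HeightOneSpectrum (RingOfIntegers E)) (N : ℕ)
    {𝔞 : Submodule (RingOfIntegers E) E} {D₀ : RingOfIntegers E} (hD : D₀ ≠ 0)
    (hden : ∀ (I : Ideal (RingOfIntegers E)) (α : E), α ∈ I • 𝔞 → ∃ β ∈ I, algebraMap (RingOfIntegers E) E β = D₀ • α)
    {α : E} (hα : α ∈ p.asIdeal ^ N • 𝔞) (h0 : α ≠ 0) :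
    ∃ σ : E →+* ℂ, ((Ideal.absNorm p.asIdeal : ℝ) ^ N) ≤
      ‖σ D₀‖ ^ Module.finrank ℚ E * ‖σ α‖ ^ Module.finrank ℚ E := by
  obtain ⟨β, hβI, hβ⟩ := hden _ α hα
  have hβ' : (β : E) = (D₀ : E) * α := by
    rw [← Algebra.smul_def]
    exact hβ
  exact rung_archimedean_size_of_denom E p N (a := 1) hβ' (fun h => p.isPrime.ne_top ((Ideal.eq_top_iff_one _).mpr h))
    (by rw [one_mul]; exact hβI) hD h0

end Summit.Ventures.HodgeRepro.Tier4.Line3
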